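import Literature.NumberTheory.EllipticCurves.LambdaAdicSelmerDataLevelProofs
import Literature.NumberTheory.EllipticCurves.PeriodIndexCorestrictionLocal
import HarnessLib

/-!
# `p`-SATURATION of the Selmer groups `Sel^{(p^k)}(E/L)` along the transition maps and of the compact Selmer
# group `S_p(E/L) = lim←_k Sel^{(p^k)}(E/L)` inside the reduce-compatible families
# («`p•x` Selmer at every level ⟹ `x` Selmer at every level»)

Support for crux stmt-BirchSwinnertonDyer-24737 `UniversalToricDescent.TwinAlgMuZeroAtThree`, line `beta-road` v10 (K2 stub
`stub_howardOutputsOfFamily`, conjunct (H-i)/(H-i′); LEAD bsd-wall-utd-p1 g24, memo `K2-JOIN-MAP-utdp1g24.md` §3, SUMMON key (k2)):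
the hypothesis `hsat` («`p•h ∈ 𝔖 ⟹ h ∈ 𝔖`») of `UniversalToricDescentFreeOfSaturated.nonempty_linearEquiv_of_saturated` (p750554)
and `UniversalToricDescentEisensteinRegular.exists_forall_ker_le_smul_top` (p750262), in the tree's levelwise currency
(`WeierstrassCurve.selmerTorsionOver`, `compactSelmerOver`, `LambdaAdicSelmerData`). GENERIC: any elliptic curve over any
number field `K`, any normal subgroup `H ≤ Γ_K` (`L = K̄^H`), any prime `p`.

The one-line argument: the local condition of `Sel^{(m)}` at `(v, σ)` is «`conj_σ x` dies in `H¹(H_{K_v}, E(K̄_v))`», and under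
the transition `p_* : H¹(H, E[p^{k+1}]) → H¹(H, E[p^k])` (induced by `P ↦ pP`) the local image gets MULTIPLIED BY `p`
(§1 `localResTorsionOverOfEmb_reduceTorsionH1`, the local twin of the tree's `torsionToGeomH1Over_reduceTorsionH1`); so if
`p•x_{k+1}` is Selmer then `x_k = p_* x_{k+1}` is Selmer (§2), for compatible families «`p•x` Selmer ⟹ `x` Selmer» (§3), and
for a pin `D : LambdaAdicSelmerData` every reduce- and norm-compatible family whose `p`-multiple lies in `𝔖_p(K_∞)` lies in
`𝔖_p(K_∞)` (§3 `exists_proj_eq_of_nsmul`). Equivalently: the local quotients `H¹(K_w, E[p^∞]-tower)/Kummer ↪ T_p H¹(K_w, E)` are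
torsion-free. This is the input making `H/𝔖` `p`-torsion-free for the ambient `Λ`-adic `H¹`, whence (i) `𝔖` reflexive ⟹ FREE
(p750554) and (ii) the compact control map at `𝔮 = (T^m + p)` injective for `m ≫ 0` (p750262) — Howard, Lemma 2.2.9 / Prop. 2.2.8.

THEOREMS ONLY; no `sorry`, no definition, no named fact; imports no `Theses` module. BSD is not proved by any of this.
References: B. Perrin-Riou, Bull. SMF 115 (1987) §0 (S_p(L), transition maps); J. Silverman, AEC VIII.§2, X.§4 (Kummer
sequence, Selmer groups); B. Howard, Compositio Math. 140 (2004), Lemma 2.2.9, Prop. 2.2.8.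
-/

set_option linter.dupNamespace false
set_option autoImplicit false

noncomputable section

open scoped Classical
open Field NumberField IsDedekindDomain

namespace Summit.BirchSwinnertonDyer.BirchSwinnertonDyer.Theorems.UniversalToricDescentCompactSelmerSaturation

open Literature.NumberTheory.EllipticCurves Literature.NumberTheory.GaloisRepresentations WeierstrassCurve

universe u

variable {K : Type u} [Field K] (W : WeierstrassCurve K) (p : ℕ) (H : Subgroup (absoluteGaloisGroup K))

/-! ## §1 The local image is multiplied by `p` under the transition map -/

section Local

variable {E : Type u} [Field E] [Algebra K E] (ι : AlgebraicClosure K →ₐ[K] AlgebraicClosure E)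

/-- **`loc_ι (p_* x) = p • loc_ι x`**: under `H¹(H, E[·]) → H¹(H_E, E(K̄_E))` the transition `p_* : H¹(H, E[p^{k+1}]) →
H¹(H, E[p^k])` becomes multiplication by `p` (both sides are the class of `τ ↦ p • ι(φ(res τ))`).
[cite: PerrinRiou1987BSMF, §0 p. 401 (transition maps induced by multiplication by p)] [cite: SilvermanAEC2009, VIII.§2] -/
theorem localResTorsionOverOfEmb_reduceTorsionH1 (k : ℕ) (x : W.torsionH1Over ((p : ℤ) ^ (k + 1)) H) :
    W.localResTorsionOverOfEmb ((p : ℤ) ^ k) H ι (W.reduceTorsionH1 p k H x) =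
      p • W.localResTorsionOverOfEmb ((p : ℤ) ^ (k + 1)) H ι x := by
  obtain ⟨φ, rfl⟩ := oneCocycleClass_surjective _ x
  rw [reduceTorsionH1, resH1Hom_oneCocycleClass, localResTorsionOverOfEmb, resH1Hom_oneCocycleClass,
    localResTorsionOverOfEmb, resH1Hom_oneCocycleClass, ← Nat.cast_smul_eq_nsmul ℤ, ← oneCocycleClass_smul]
  refine congrArg (oneCocycleClass _) (Subtype.ext (ContinuousMap.ext fun τ ↦ ?_))
  rw [pullback_resHomOfEquivariant_apply, pullback_resHomOfEquivariant_apply, Submodule.coe_smul,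
    ContinuousMap.smul_apply, pullback_resHomOfEquivariant_apply, AddMonoidHom.coe_comp, Function.comp_apply,
    AddMonoidHom.coe_comp, Function.comp_apply, AddSubgroup.coe_subtype, AddSubgroup.coe_subtype,
    coe_geomTorsionReduce, map_zsmul, Nat.cast_smul_eq_nsmul]
  rfl

end Local

/-! ## §2 One step: `p • x` Selmer ⟹ `p_* x` Selmer -/

section Selmer

variable [NumberField K] [H.Normal]

/-- Unpacking / repacking the Selmer conditions of `Sel^{(m)}(E/K̄^H)` at all places and conjugators.
[cite: PerrinRiou1987BSMF, §0 p. 401] -/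
theorem mem_selmerTorsionOver_iff (m : ℤ) (x : W.torsionH1Over m H) :
    x ∈ W.selmerTorsionOver H m ↔
      (∀ (v : HeightOneSpectrum (𝓞 K)) (σ : absoluteGaloisGroup K),
        W.localResTorsionOverOfEmb m H (closureEmb (K := K) (v.adicCompletion K))
          (Literature.NumberTheory.EllipticCurves.conjH1 H (geomTorsion W m) σ x) = 0) ∧
      ∀ (w : InfinitePlace K) (σ : absoluteGaloisGroup K),
        W.localResTorsionOverOfEmb m H (closureEmb (K := K) w.Completion)
          (Literature.NumberTheory.EllipticCurves.conjH1 H (geomTorsion W m) σ x) = 0 := by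
  simp only [selmerTorsionOver, AddSubgroup.mem_inf, AddSubgroup.mem_iInf, AddSubgroup.mem_comap,
    AddMonoidHom.mem_ker]

/-- **`p • x ∈ Sel^{(p^{k+1})} ⟹ p_* x ∈ Sel^{(p^k)}`**: at each `(v, σ)` the local image of `p_* x` is `p` times that of
`x` (§1), i.e. the local image of `p • x`, which vanishes. [cite: SilvermanAEC2009, X.§4 (the Kummer sequence and Selmer groups)] [cite: PerrinRiou1987BSMF, §0 p. 401] -/
theorem reduceTorsionH1_mem_selmerTorsionOver_of_nsmul_mem (k : ℕ) (x : W.torsionH1Over ((p : ℤ) ^ (k + 1)) H)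
    (hx : p • x ∈ W.selmerTorsionOver H ((p : ℤ) ^ (k + 1))) :
    W.reduceTorsionH1 p k H x ∈ W.selmerTorsionOver H ((p : ℤ) ^ k) := by
  rw [mem_selmerTorsionOver_iff] at hx ⊢
  refine ⟨fun v σ => ?_, fun w σ => ?_⟩
  · rw [← LambdaAdicSelmerDataExists.reduceTorsionH1_conjH1 W p H k σ x, localResTorsionOverOfEmb_reduceTorsionH1, ← map_nsmul,
      ← map_nsmul]
    exact hx.1 v σ
  · rw [← LambdaAdicSelmerDataExists.reduceTorsionH1_conjH1 W p H k σ x, localResTorsionOverOfEmb_reduceTorsionH1, ← map_nsmul,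
      ← map_nsmul]
    exact hx.2 w σ

/-! ## §3 Families: `p • x` Selmer at every level ⟹ `x` Selmer at every level; the pin form -/

/-- **Saturation along a reduce-compatible family**: if `p_* x_{k+1} = x_k` for all `k` and every `p • x_k` is Selmer, then
every `x_k` is Selmer. [cite: PerrinRiou1987BSMF, §0 p. 401] [cite: Howard2004HeegnerKolyvagin, Lemma 2.2.9] -/
theorem forall_mem_selmerTorsionOver_of_nsmul (x : Π k : ℕ, W.torsionH1Over ((p : ℤ) ^ k) H)
    (hred : ∀ k, W.reduceTorsionH1 p k H (x (k + 1)) = x k)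
    (hsel : ∀ k, p • x k ∈ W.selmerTorsionOver H ((p : ℤ) ^ k)) :
    ∀ k, x k ∈ W.selmerTorsionOver H ((p : ℤ) ^ k) := by
  intro k
  rw [← hred k]
  exact reduceTorsionH1_mem_selmerTorsionOver_of_nsmul_mem W p H k (x (k + 1)) (hsel (k + 1))

/-- **`S_p(E/L)` is `p`-saturated in the reduce-compatible families**: `p • x ∈ S_p(E/L)` and `x` reduce-compatible ⟹
`x ∈ S_p(E/L)`. [cite: PerrinRiou1987BSMF, §0 p. 401] [cite: Howard2004HeegnerKolyvagin, Lemma 2.2.9] -/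
theorem mem_compactSelmerOver_of_nsmul_mem (x : Π k : ℕ, W.torsionH1Over ((p : ℤ) ^ k) H)
    (hred : ∀ k, W.reduceTorsionH1 p k H (x (k + 1)) = x k) (hsel : p • x ∈ W.compactSelmerOver H p) :
    x ∈ W.compactSelmerOver H p := by
  rw [mem_compactSelmerOver_iff] at hsel ⊢
  exact ⟨forall_mem_selmerTorsionOver_of_nsmul W p H x hred fun k => hsel.1 k, hred⟩

/-- The same with the weaker hypothesis «`p • x_k` Selmer at every level» (no compatibility asked of `p • x`).
[cite: PerrinRiou1987BSMF, §0 p. 401] -/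
theorem mem_compactSelmerOver_of_forall_nsmul_mem (x : Π k : ℕ, W.torsionH1Over ((p : ℤ) ^ k) H)
    (hred : ∀ k, W.reduceTorsionH1 p k H (x (k + 1)) = x k)
    (hsel : ∀ k, p • x k ∈ W.selmerTorsionOver H ((p : ℤ) ^ k)) :
    x ∈ W.compactSelmerOver H p :=
  (W.mem_compactSelmerOver_iff H p x).mpr ⟨forall_mem_selmerTorsionOver_of_nsmul W p H x hred hsel, hred⟩

end Selmer

/-! ## §4 The pin `𝔖_p(K_∞)`: families whose `p`-multiple comes from `𝔖` come from `𝔖` -/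

section Pin

variable [NumberField K] [Fact p.Prime] {κ : ZpExtension K p} {γ : absoluteGaloisGroup K}
  (D : W.LambdaAdicSelmerData κ γ)

/-- **`𝔖_p(K_∞)` is `p`-saturated in the ambient reduce- and norm-compatible families** (pin form): a family
`x = (x_{n,k})`, reduce-compatible in `k`, norm-compatible in `n`, with every `p • x_{n,k}` Selmer, comes from `𝔖`.
With `𝔖 ↪ H¹(K_Σ/K, 𝐓)` this is the `p`-torsion-freeness of `H/𝔖` used by Howard's Lemma 2.2.9 / Prop. 2.2.8 arguments
(freeness of `𝔖`, p750554; injective compact control at `𝔮 = (T^m + p)`, p750262).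
[cite: Howard2004HeegnerKolyvagin, Lemma 2.2.9 and Prop. 2.2.8] [cite: PerrinRiou1987BSMF, §0 pp. 401–402] -/
theorem exists_proj_eq_of_forall_nsmul_mem
    (x : Π n k : ℕ, W.torsionH1Over ((p : ℤ) ^ k) (κ.layerSubgroup n))
    (hred : ∀ n k, W.reduceTorsionH1 p k (κ.layerSubgroup n) (x n (k + 1)) = x n k)
    (hnorm : ∀ n, W.resPi p (κ.layerSubgroup_antitone (Nat.le_succ n)) (x n) =
      ∑ i ∈ Finset.range p, W.conjPi p (κ.layerSubgroup (n + 1)) (γ ^ (p ^ n * i)) (x (n + 1)))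
    (hsel : ∀ n k, p • x n k ∈ W.selmerTorsionOver (κ.layerSubgroup n) ((p : ℤ) ^ k)) :
    ∃ s : D.S, ∀ n, D.proj n s = x n :=
  D.surj x (fun n => mem_compactSelmerOver_of_forall_nsmul_mem W p (κ.layerSubgroup n) (x n) (hred n) (hsel n)) hnorm

/-- The same with the hypothesis «`p • x` is the image of an element of `𝔖`»: if `D.proj n s' = p • x n` for all `n`
(and `x` is reduce- and norm-compatible), then `x = D.proj · s` for some `s ∈ 𝔖`.
[cite: Howard2004HeegnerKolyvagin, Lemma 2.2.9 and Prop. 2.2.8] -/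
theorem exists_proj_eq_of_proj_eq_nsmul
    (x : Π n k : ℕ, W.torsionH1Over ((p : ℤ) ^ k) (κ.layerSubgroup n))
    (hred : ∀ n k, W.reduceTorsionH1 p k (κ.layerSubgroup n) (x n (k + 1)) = x n k)
    (hnorm : ∀ n, W.resPi p (κ.layerSubgroup_antitone (Nat.le_succ n)) (x n) =
      ∑ i ∈ Finset.range p, W.conjPi p (κ.layerSubgroup (n + 1)) (γ ^ (p ^ n * i)) (x (n + 1)))
    (s' : D.S) (hs' : ∀ n, D.proj n s' = p • x n) :
    ∃ s : D.S, ∀ n, D.proj n s = x n := by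
  refine exists_proj_eq_of_forall_nsmul_mem W p D x hred hnorm fun n k => ?_
  have hmem := ((W.mem_compactSelmerOver_iff (κ.layerSubgroup n) p (D.proj n s')).mp (D.proj_mem n s')).1 k
  rw [hs' n] at hmem
  exact hmem

end Pin

end Summit.BirchSwinnertonDyer.BirchSwinnertonDyer.Theorems.UniversalToricDescentCompactSelmerSaturation

end
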